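/-
Copyright (c) 2026 the pub-hodgecm-mathlib formalisation cell (harness21).  Prover seat hodgecm-mathlib-K2E5-p01 (g4) (free E5 hand, cross-unit), HCML Track B «K2-LIT»,
h413 = `stmt-HodgeConjecture-24833`, line `K2_E3_EllipticInputs`, unit U12, socket #11 road (SC-an), sub-line «HC-D-ε» (sub-lead K2E3-p21 (g3), CONVENTION v1
`K2/STATUS.md` 2026-09-04T02:46:50Z), file (ε7), dealt by the (SC-an) lead K2E3-p14 (g3) RULINGS #6 (R6-2).  Exponent-parametric twin of ★ `F0P3cStCharTSWeylDiscrLocInt`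
(F0P2-p01, road «HC-D» terminal brick D7).  2026-09-04.
-/
import Summits.HodgeConjecture.HodgeConjecture.Theorems.F0P3cStCharTSWeylDiscrLocInt   -- ★ D7 at `r = 1∕4` (F0P2-p01): `token_localNonsplitEquiv_eq`, `locallyIntegrable_weylDiscr_inv`; brings ★ D7-prep `…HCDLocIntTransport`, ★ `continuous_dgFormula`, ★ `localNonsplitEquiv`, `Gqs`
import Summits.HodgeConjecture.HodgeConjecture.Theorems.K2E3HCDGroupToLieRpow         -- ★ (ε5) p856877 (K2E3-p21): the `ℝ≥0∞` dictionary `coe_rpow_neg_quarter`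
import Mathlib.Analysis.SpecialFunctions.Pow.Continuity
import Summits.HodgeConjecture.HodgeConjecture.Theorems.K2E3HCDModelRpow               -- ★ (ε6) (K2E3-p21): the hypothesis-free model statement `hcd_model_rpow` at exponent `r` (ED. 2)
import HarnessLib

/-!
# K2 · E3 · (SC-an) sub-line «HC-D-ε», file (ε7): THE TERMINAL TRANSPORT OF ROAD «HC-D» AT A REAL EXPONENT `r` —
# `g ↦ |D_G(g)|^{−2r} = (N(discr χ_g) · N(det g)⁻²)^{−r} ∈ L¹_loc(U(Φ₃)(L⁺_v))` FROM the one-place MODEL STATEMENT at exponent `r`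

Cell `pub/hodgecm-mathlib`, crux H413 = `stmt-HodgeConjecture-24833` (lane `--supports … --as helper`, count-neutral); (SC-an) line lead K2E3-p14 (g3), dealer K2E3-plan (g2),
HC-D-ε sub-lead K2E3-p21 (g3).  THEOREMS ONLY (no `def` ∕ `instance` ∕ `notation` ∕ named fact ∕ `sorry`); ★-only imports.

WHAT.  ★ D7 `F0P3cStCharTSWeylDiscrLocInt` turns the road's MODEL STATEMENT «every point of `U(σ_w, Φ₃)(L_w)` has a neighbourhood of finite `∫⁻` of the group token»
into the `hDGliO` hypothesis `LocallyIntegrable (g ↦ (√√T(g))⁻¹) νQv` on `Gqs L v = U(Φ₃)(L⁺_v)`, `T(g) = ∏_w N_w(discr χ_g) · (∏_w N_w(det g))⁻² : ℝ≥0`, at the frozen exponent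
(`√√` = the power `1∕4`).  THIS FILE is its twin at a REAL exponent `r ≥ 0` (CONVENTION v1 (T1)): the model token is (ε5)'s `θᵣ A = (↑(N(discr χ_A) · N(det A)⁻²))^(−r)`
(`ℝ≥0∞`-valued `rpow`) and the conclusion is the REAL-valued `LocallyIntegrable (g ↦ (↑T(g) : ℝ) ^ (−r)) νQv` — the shape (ε8) feeds to ★ p856410
`K2E3LogWeightLocallyIntegrable.locallyIntegrable_inv_mul_log_pow` at `r = (1+δ)∕4` (the bridge `((√√T)^{1+δ})⁻¹ = T^{−(1+δ)∕4}` is §0 ∕ §4 here, as (T3) asked).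
* §0 dictionary (generic `ℝ≥0`): `coe_rpow_neg_quarter_real` (`(↑t : ℝ)^(−1∕4) = (↑√√t)⁻¹`), `inv_coe_sqrt_sqrt_rpow_eq` (`((↑√√t)^{1+δ})⁻¹ = (↑t)^(−(1+δ)∕4)`),
  **`enorm_coe_rpow_neg_le`** (`‖(↑t : ℝ)^(−r)‖ₑ ≤ (↑t : ℝ≥0∞)^(−r)` for `r ≥ 0` — equality for `t ≠ 0`; at `t = 0`, `r > 0` the real side is Lean's `0` and the token is `⊤`).
* §1 (CM, `v` non-split, `w ∣ v`): `tokenNN_localNonsplitEquiv_eq` — the `√`-FREE identity «model token of `e g` = CM token of `g`» (from ★ `token_localNonsplitEquiv_eq` by injectivity of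
  `x ↦ (↑√√x)⁻¹`), `theta_rpow_localNonsplitEquiv_eq` (its `rpow` image), `continuous_tokenNN` ∕ `continuous_sqrt_sqrt_tokenNN` (from ★ `continuous_dgFormula`).
* §2 **`locallyIntegrable_weylDiscr_rpow_neg_of_model`** = ★ `…_of_model` at exponent `r`; §3 **`locallyIntegrable_weylDiscr_rpow_neg_of_forall_model`** = ★ `…_of_forall_model` at
  exponent `r` — the MODEL binder is EXACTLY the head shape of (ε6) `K2E3HCDModelRpow.hcd_model_rpow` (sub-lead, in flight), kept as a HYPOTHESIS; the unconditional
  `locallyIntegrable_weylDiscr_rpow_neg … {r} (hr0) (hr5)` is the one-line ED. 2 `…_of_forall_model (fun L _ _ _ v w hw _ _ ν′ _ g₀ => hcd_model_rpow … ν′ g₀)` once (ε6) is ★.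
* §4 the (ε8) bridge **`locallyIntegrable_inv_sqrt_sqrt_pow_of_rpow`** (`T^{−(1+δ)∕4} ∈ L¹_loc ⇒ ((√√T)^{1+δ})⁻¹ ∈ L¹_loc`, ★ p856410's `hint` verbatim with `φ := √√T`).
* §5 consistency at `r = 1∕4`: `locallyIntegrable_weylDiscr_rpow_neg_quarter`, UNCONDITIONAL, from ★ `locallyIntegrable_weylDiscr_inv` through §0.

HONEST LABEL: HC_CM is proved only modulo the 7 printed citations (2 remaining named inputs: hLiu418 = `stmt-HodgeConjecture-24832`, h413 = `stmt-HodgeConjecture-24833`)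
until rung 0 closes; count-neutral helper ((ε7) of the 8-file HC-D-ε sub-line; (SC-an) is NOT ★; this file is CONDITIONAL on the (ε6) model statement except §5).

## References
* [HarishChandra1970] Harish-Chandra (notes by G. van Dijk), *Harmonic Analysis on Reductive p-adic Groups*, LNM 162 (1970), Part VII §1 Theorem 15 p. 63 (`|D|^{−1∕2−ε}`
  locally summable), §3 p. 73.
* [Rogawski1990] J. D. Rogawski, *Automorphic Representations of Unitary Groups in Three Variables* (1990), §4.9 p. 54 (`D_G`), §12.5 p. 182.
* [PlatonovRapinchuk1994] V. Platonov, A. Rapinchuk, *Algebraic Groups and Number Theory* (1994), §5.1 (the one-place model at a non-split place).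
-/

set_option autoImplicit false
-- the mandated namespace has the single-problem summit's repeated segment (`HodgeConjecture.HodgeConjecture`)
set_option linter.dupNamespace false

noncomputable section

open MeasureTheory Filter Topology Polynomial Set
open NumberField IsDedekindDomain
open scoped NNReal ENNReal Matrix MatrixGroups
open Literature.NumberTheory.Automorphic Literature.NumberTheory.Automorphic.UnitaryGroup
open Literature.NumberTheory.GaloisRepresentations Literature.NumberTheory.GaloisRepresentations.IsNonarchimedeanLocalField
open Literature.NumberTheory.Rogawski1990
open Summit.HodgeConjecture.HodgeConjecture.Cruxes.H413.F0P3cStCharTSHCDLocIntTransport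
open Summit.HodgeConjecture.HodgeConjecture.Cruxes.H413.F0P3cStCharTSWeylDiscrLocInt
open Summit.HodgeConjecture.HodgeConjecture.Cruxes.H413.K2E3HCDGroupToLieRpow

namespace Summit.HodgeConjecture.HodgeConjecture.Cruxes.H413.K2E3WeylDiscrLocIntRpow

/-! ## §0 The real ∕ extended-real dictionary at a real exponent -/

/-- `(↑t : ℝ)^(−1∕4) = ((↑√√t : ℝ))⁻¹` for `t : ℝ≥0` — the REAL twin of ★ (ε5) `coe_rpow_neg_quarter`. [cite: HarishChandra1970, Part VII §1 Thm. 15] -/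
theorem coe_rpow_neg_quarter_real (t : ℝ≥0) : ((t : ℝ)) ^ (-(1 / 4 : ℝ)) = (((NNReal.sqrt (NNReal.sqrt t) : ℝ≥0) : ℝ))⁻¹ := by
  rw [Real.rpow_neg t.coe_nonneg, NNReal.sqrt_eq_rpow, NNReal.sqrt_eq_rpow, ← NNReal.rpow_mul, NNReal.coe_rpow]
  norm_num

/-- `(((↑√√t : ℝ))^(1+δ))⁻¹ = (↑t : ℝ)^(−(1+δ)∕4)` for `t : ℝ≥0` and every real `δ` — the (T3) bridge between ★ p856410's `hint` (`φ := √√T`) and the (T1) token.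
[cite: HarishChandra1970, Part VII §3 p. 73] -/
theorem inv_coe_sqrt_sqrt_rpow_eq (t : ℝ≥0) (δ : ℝ) :
    ((((NNReal.sqrt (NNReal.sqrt t) : ℝ≥0) : ℝ)) ^ (1 + δ))⁻¹ = ((t : ℝ)) ^ (-((1 + δ) / 4)) := by
  rw [Real.rpow_neg t.coe_nonneg, NNReal.sqrt_eq_rpow, NNReal.sqrt_eq_rpow, ← NNReal.rpow_mul, NNReal.coe_rpow, ← Real.rpow_mul t.coe_nonneg]
  norm_num
  ring_nf

/-- **`‖(↑t : ℝ)^(−r)‖ₑ ≤ (↑t : ℝ≥0∞)^(−r)`** for `t : ℝ≥0`, `r ≥ 0`: equality when `t ≠ 0` (`ENNReal.ofReal_rpow_of_pos`); at `t = 0`, `r > 0` the real power is Lean's `0` while the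
token is `⊤`; at `r = 0` both are `1`.  The pointwise comparison between the REAL integrand and the road's `ℝ≥0∞` token — no null-set argument needed (twin of ★
`enorm_inv_coe_le_inv_coe`). [folklore] -/
theorem enorm_coe_rpow_neg_le (t : ℝ≥0) {r : ℝ} (hr : 0 ≤ r) : ‖((t : ℝ)) ^ (-r)‖ₑ ≤ ((t : ℝ≥0∞)) ^ (-r) := by
  rcases eq_or_ne t 0 with ht | ht
  · subst ht
    rcases eq_or_lt_of_le hr with hr0 | hr0
    · rw [← hr0, neg_zero, Real.rpow_zero, ENNReal.rpow_zero, enorm_one]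
    · rw [NNReal.coe_zero, Real.zero_rpow (neg_ne_zero.2 hr0.ne'), enorm_zero]
      exact bot_le
  · have ht' : (0 : ℝ) < t := by exact_mod_cast pos_iff_ne_zero.2 ht
    rw [Real.enorm_eq_ofReal (Real.rpow_nonneg t.coe_nonneg _), ← ENNReal.ofReal_rpow_of_pos ht', ENNReal.ofReal_coe_nnreal]

/-! ## §1 The `w`-component identities at a non-split place, `√`-free, and their `rpow` images -/

section CM

variable (L : Type) [Field L] [NumberField L] [IsCMField L] (v : HeightOneSpectrum (𝓞 ↥(maximalRealSubfield L)))
  (w : PlacesOver L v) (hw : IsCMField.complexConj L • w.1 = w.1)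

/-- **Model token of `e g` = CM token of `g`, `√`-FREE** (`ℝ≥0`): `N(discr χ_{e g}) · N(det (e g))⁻² = ∏_{w′} N_{w′}(discr χ_g) · (∏_{w′} N_{w′}(det g))⁻²` for `e = localNonsplitEquiv`
at a non-split `v` — from ★ `token_localNonsplitEquiv_eq` (the same identity under `x ↦ (↑√√x)⁻¹`) by injectivity of `⁻¹`, `↑` and `NNReal.sqrt`. [cite: PlatonovRapinchuk1994, §5.1] -/
theorem tokenNN_localNonsplitEquiv_eq (g : Gqs L v) :
    (normAbs (w.1.adicCompletion L) (((((localNonsplitEquiv (IsCMField.complexConj L) (qsForm L) (IsCMField.complexConj_ne_one L) w hw) g : ↥(unitaryGroupOfForm (galAdicCompletionMap (L := L) (IsCMField.complexConj L) hw) (placeForm (qsForm L) w.1))) : GL (Fin 3) (w.1.adicCompletion L)) : Matrix (Fin 3) (Fin 3) (w.1.adicCompletion L))).charpoly.discr * ((normAbs (w.1.adicCompletion L) (((((localNonsplitEquiv (IsCMField.complexConj L) (qsForm L) (IsCMField.complexConj_ne_one L) w hw) g : ↥(unitaryGroupOfForm (galAdicCompletionMap (L := L) (IsCMField.complexConj L)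 hw) (placeForm (qsForm L) w.1))) : GL (Fin 3) (w.1.adicCompletion L)) : Matrix (Fin 3) (Fin 3) (w.1.adicCompletion L))).det) ^ 2)⁻¹) = ((∏ w' : PlacesOver L v, normAbs (w'.1.adicCompletion L) ((((g.val : GL (Fin 3) (UnitaryGroup.LocalRing L v)).val).charpoly.discr) w')) * ((∏ w' : PlacesOver L v, normAbs (w'.1.adicCompletion L) ((((g.val : GL (Fin 3) (UnitaryGroup.LocalRing L v)).val).det) w')) ^ 2)⁻¹) := by
  have h := token_localNonsplitEquiv_eq L v w hw g
  exact NNReal.sqrt.injective (NNReal.sqrt.injective (ENNReal.coe_inj.1 (inv_inj.1 h)))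

/-- **`θᵣ (e g) = (↑T(g))^(−r)`**: the (ε5) model token at `e g` is the `rpow` image of the CM token of `g` (every real `r`). [cite: PlatonovRapinchuk1994, §5.1] -/
theorem theta_rpow_localNonsplitEquiv_eq (g : Gqs L v) (r : ℝ) :
    ((((normAbs (w.1.adicCompletion L) (((((localNonsplitEquiv (IsCMField.complexConj L) (qsForm L) (IsCMField.complexConj_ne_one L) w hw) g : ↥(unitaryGroupOfForm (galAdicCompletionMap (L := L) (IsCMField.complexConj L) hw) (placeForm (qsForm L) w.1))) : GL (Fin 3) (w.1.adicCompletion L)) : Matrix (Fin 3) (Fin 3) (w.1.adicCompletion L))).charpoly.discr * ((normAbs (w.1.adicCompletion L) (((((localNonsplitEquiv (IsCMField.complexConj L) (qsForm L) (IsCMField.complexConj_ne_one L) w hw) g : ↥(unitaryGroupOfForm (galAdicCompletionMap (L := L) (IsCMField.complexConj L) hw) (placeForm (qsForm L) w.1))) : GL (Fin 3) (w.1.adicCompletion L)) : Matrix (Fin 3) (Fin 3) (w.1.adicCompletion L))).det) ^ 2)⁻¹) : ℝ≥0) : ℝ≥0∞)) ^ (-r) = (((((∏ w' : PlacesOver L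 v, normAbs (w'.1.adicCompletion L) ((((g.val : GL (Fin 3) (UnitaryGroup.LocalRing L v)).val).charpoly.discr) w')) * ((∏ w' : PlacesOver L v, normAbs (w'.1.adicCompletion L) ((((g.val : GL (Fin 3) (UnitaryGroup.LocalRing L v)).val).det) w')) ^ 2)⁻¹) : ℝ≥0) : ℝ≥0∞)) ^ (-r) := by
  exact congrArg (fun x : ℝ≥0 => ((x : ℝ≥0∞)) ^ (-r)) (tokenNN_localNonsplitEquiv_eq L v w hw g)

end CM

section Token

variable (L : Type) [Field L] [NumberField L] [IsCMField L] (v : HeightOneSpectrum (𝓞 ↥(maximalRealSubfield L)))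

set_option synthInstance.maxHeartbeats 400000 in
-- instance search on the CM carrier `Gqs L v` is deep (as in ★ D7): raise the typeclass budget for this declaration only
/-- **`g ↦ √√T(g)` is continuous** (`ℝ≥0`-valued; ★ `continuous_dgFormula` is its `ℝ`-coercion) — the `φ` of ★ p856410 for the (ε8) assembler. [cite: Rogawski1990, §4.9 p. 54] -/
theorem continuous_sqrt_sqrt_tokenNN :
    Continuous fun g : Gqs L v => NNReal.sqrt (NNReal.sqrt ((∏ w : PlacesOver L v, IsNonarchimedeanLocalField.normAbs (w.1.adicCompletion L) (((g.val : GL (Fin 3) (UnitaryGroup.LocalRing L v)).val.charpoly.discr) w)) * ((∏ w : PlacesOver L v, IsNonarchimedeanLocalField.normAbs (w.1.adicCompletion L) (((g.val : GL (Fin 3) (UnitaryGroup.LocalRing L v)).val.det) w)) ^ 2)⁻¹)) := by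
  have h := continuous_real_toNNReal.comp (F0P3cStCharTSDGField.continuous_dgFormula L v)
  simpa only [Function.comp_def, Real.toNNReal_coe] using h

set_option synthInstance.maxHeartbeats 400000 in
-- instance search on the CM carrier `Gqs L v` is deep (as in ★ D7): raise the typeclass budget for this declaration only
/-- **The `√`-free CM token `g ↦ T(g) = ∏_w N_w(discr χ_g) · (∏_w N_w(det g))⁻²` is continuous** (`T = ((√√T)²)²`). [cite: Rogawski1990, §4.9 p. 54] -/
theorem continuous_tokenNN :
    Continuous fun g : Gqs L v => ((∏ w : PlacesOver L v, IsNonarchimedeanLocalField.normAbs (w.1.adicCompletion L) (((g.val : GL (Fin 3) (UnitaryGroup.LocalRing L v)).val.charpoly.discr) w)) * ((∏ w : PlacesOver L v, IsNonarchimedeanLocalField.normAbs (w.1.adicCompletion L) (((g.val : GL (Fin 3) (UnitaryGroup.LocalRing L v)).val.det) w)) ^ 2)⁻¹) := by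
  have h2 : Continuous fun g : Gqs L v => (NNReal.sqrt (NNReal.sqrt ((∏ w : PlacesOver L v, IsNonarchimedeanLocalField.normAbs (w.1.adicCompletion L) (((g.val : GL (Fin 3) (UnitaryGroup.LocalRing L v)).val.charpoly.discr) w)) * ((∏ w : PlacesOver L v, IsNonarchimedeanLocalField.normAbs (w.1.adicCompletion L) (((g.val : GL (Fin 3) (UnitaryGroup.LocalRing L v)).val.det) w)) ^ 2)⁻¹)) ^ 2) ^ 2 :=
    Continuous.pow (Continuous.pow (continuous_sqrt_sqrt_tokenNN L v) 2) 2
  refine h2.congr fun g => ?_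
  rw [NNReal.sq_sqrt, NNReal.sq_sqrt]

end Token

/-! ## §2 The terminal theorem at exponent `r`, modulo the model statement -/

set_option synthInstance.maxHeartbeats 400000 in
-- instance search on the CM carrier `Gqs L v` is deep (as in ★ D7): raise the typeclass budget for this declaration only
/-- **(HC-D-ε) FROM THE MODEL STATEMENT AT EXPONENT `r`** (twin of ★ `locallyIntegrable_weylDiscr_inv_of_model`).  `L v hns νQv` as in the organ prefix; `w ∣ v` the place above
`v`; `e := localNonsplitEquiv`; `r ≥ 0`.  IF on the one-place model `U(σ_w, Φ₃)(L_w)` every point has a neighbourhood on which the (ε5) token `θᵣ` has finite `∫⁻` against `νQv.map e`,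
THEN `g ↦ (↑T(g) : ℝ)^(−r)` is locally integrable on `Gqs L v` — transport along `e` (★ D7-prep), the `√`-free `w`-component identity (§1), the pointwise comparison
`enorm_coe_rpow_neg_le`, measurability from `continuous_tokenNN`. [cite: HarishChandra1970, Part VII §1 Thm. 15 p. 63] [cite: Rogawski1990, §4.9 p. 54; §12.5 p. 182] -/
theorem locallyIntegrable_weylDiscr_rpow_neg_of_model
    (L : Type) [Field L] [NumberField L] [IsCMField L] (v : HeightOneSpectrum (𝓞 ↥(maximalRealSubfield L)))
    (w : PlacesOver L v) (hw : IsCMField.complexConj L • w.1 = w.1)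
    [MeasurableSpace (Gqs L v)] [BorelSpace (Gqs L v)] (νQv : Measure (Gqs L v))
    [MeasurableSpace ↥(unitaryGroupOfForm (galAdicCompletionMap (L := L) (IsCMField.complexConj L) hw) (placeForm (qsForm L) w.1))]
    [BorelSpace ↥(unitaryGroupOfForm (galAdicCompletionMap (L := L) (IsCMField.complexConj L) hw) (placeForm (qsForm L) w.1))] {r : ℝ} (hr0 : 0 ≤ r)
    (hModel : ∀ g₀ : ↥(unitaryGroupOfForm (galAdicCompletionMap (L := L) (IsCMField.complexConj L) hw) (placeForm (qsForm L) w.1)),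
      ∃ U ∈ 𝓝 g₀, ∫⁻ g in U, ((((normAbs (w.1.adicCompletion L) ((((g : ↥(unitaryGroupOfForm (galAdicCompletionMap (L := L) (IsCMField.complexConj L) hw) (placeForm (qsForm L) w.1))) : GL (Fin 3) (w.1.adicCompletion L)) : Matrix (Fin 3) (Fin 3) (w.1.adicCompletion L))).charpoly.discr * ((normAbs (w.1.adicCompletion L) ((((g : ↥(unitaryGroupOfForm (galAdicCompletionMap (L := L) (IsCMField.complexConj L) hw) (placeForm (qsForm L) w.1))) : GL (Fin 3) (w.1.adicCompletion L)) : Matrix (Fin 3) (Fin 3) (w.1.adicCompletion L))).det) ^ 2)⁻¹) : ℝ≥0) : ℝ≥0∞)) ^ (-r)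
        ∂((νQv).map (fun g : Gqs L v => ((localNonsplitEquiv (IsCMField.complexConj L) (qsForm L) (IsCMField.complexConj_ne_one L) w hw) g : ↥(unitaryGroupOfForm (galAdicCompletionMap (L := L) (IsCMField.complexConj L) hw) (placeForm (qsForm L) w.1))))) < ∞) :
    LocallyIntegrable (fun g : (Gqs L v) => (((((∏ w : PlacesOver L v, IsNonarchimedeanLocalField.normAbs (w.1.adicCompletion L) (((g.val : GL (Fin 3) (UnitaryGroup.LocalRing L v)).val.charpoly.discr) w)) * ((∏ w : PlacesOver L v, IsNonarchimedeanLocalField.normAbs (w.1.adicCompletion L) (((g.val : GL (Fin 3) (UnitaryGroup.LocalRing L v)).val.det) w)) ^ 2)⁻¹) : ℝ≥0) : ℝ)) ^ (-r)) νQv := by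
  -- `e` read on the carrier `Gqs L v` with ITS topology instance (definitionally the domain of `localNonsplitEquiv`)
  let e' : Gqs L v ≃ₜ* ↥(unitaryGroupOfForm (galAdicCompletionMap (L := L) (IsCMField.complexConj L) hw) (placeForm (qsForm L) w.1)) :=
    (localNonsplitEquiv (IsCMField.complexConj L) (qsForm L) (IsCMField.complexConj_ne_one L) w hw)
  -- transport the neighbourhood bounds along `e'`
  have hT := forall_exists_setLIntegral_comp_lt_top_of_map_mulEquiv e' νQv _ hModel
  -- the real integrand is measurable: a real power of the continuous `ℝ≥0`-valued token
  have hmeas : Measurable fun g : Gqs L v => (((((∏ w : PlacesOver L v, IsNonarchimedeanLocalField.normAbs (w.1.adicCompletion L) (((g.val : GL (Fin 3) (UnitaryGroup.LocalRing L v)).val.charpoly.discr) w)) * ((∏ w : PlacesOver L v, IsNonarchimedeanLocalField.normAbs (w.1.adicCompletion L) (((g.val : GL (Fin 3) (UnitaryGroup.LocalRing L v)).val.det) w)) ^ 2)⁻¹) : ℝ≥0) : ℝ)) ^ (-r) :=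
    (NNReal.continuous_coe.comp (continuous_tokenNN L v)).measurable.pow_const _
  refine locallyIntegrable_of_forall_exists_setLIntegral_lt_top hmeas.aestronglyMeasurable
    (fun g : Gqs L v => (((((∏ w' : PlacesOver L v, normAbs (w'.1.adicCompletion L) ((((g.val : GL (Fin 3) (UnitaryGroup.LocalRing L v)).val).charpoly.discr) w')) * ((∏ w' : PlacesOver L v, normAbs (w'.1.adicCompletion L) ((((g.val : GL (Fin 3) (UnitaryGroup.LocalRing L v)).val).det) w')) ^ 2)⁻¹) : ℝ≥0) : ℝ≥0∞)) ^ (-r)) (fun g => ?_) (fun g => ?_)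
  · -- pointwise comparison with the token
    exact enorm_coe_rpow_neg_le _ hr0
  · -- the transported bound, rewritten by §1
    obtain ⟨U, hU, hfin⟩ := hT g
    refine ⟨U, hU, ?_⟩
    refine lt_of_le_of_lt (le_of_eq ?_) hfin
    refine lintegral_congr fun x => ?_
    exact (theta_rpow_localNonsplitEquiv_eq L v w hw x r).symm

/-! ## §3 The universal-model form (docking point for (ε6) `hcd_model_rpow`) -/

set_option synthInstance.maxHeartbeats 400000 in
-- instance search on the CM carrier `Gqs L v` is deep (as in ★ D7): raise the typeclass budget for this declaration only
/-- **(HC-D-ε) FROM THE MODEL THEOREM AT EXPONENT `r`, universal form** (twin of ★ `locallyIntegrable_weylDiscr_inv_of_forall_model`).  If for EVERY CM field `L`, place `v`, place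
`w ∣ v` fixed by complex conjugation, Borel structure and HAAR measure `ν′` on the one-place model, every point has a neighbourhood of finite `∫⁻` of the (ε5) token `θᵣ` — the
shape of (ε6) `K2E3HCDModelRpow.hcd_model_rpow` at this `r` — then for every non-split `v` and every Haar `νQv`, `g ↦ (↑T(g) : ℝ)^(−r) ∈ L¹_loc(Gqs L v)` (§2 at `ν′ := νQv.map e`,
Haar by `ContinuousMulEquiv.isHaarMeasure_map`, Borel structure `borel _` on the model).  ED. 2 discharges `MODEL` by name once (ε6) is ★.
[cite: HarishChandra1970, Part VII §1 Thm. 15 p. 63] [cite: PlatonovRapinchuk1994, §5.1] -/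
theorem locallyIntegrable_weylDiscr_rpow_neg_of_forall_model {r : ℝ} (hr0 : 0 ≤ r)
    (MODEL : ∀ (L : Type) [Field L] [NumberField L] [IsCMField L] (v : HeightOneSpectrum (𝓞 ↥(maximalRealSubfield L)))
      (w : PlacesOver L v) (hw : IsCMField.complexConj L • w.1 = w.1)
      [MeasurableSpace ↥(unitaryGroupOfForm (galAdicCompletionMap (L := L) (IsCMField.complexConj L) hw) (placeForm (qsForm L) w.1))] [BorelSpace ↥(unitaryGroupOfForm (galAdicCompletionMap (L := L) (IsCMField.complexConj L) hw) (placeForm (qsForm L) w.1))]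
      (ν' : Measure ↥(unitaryGroupOfForm (galAdicCompletionMap (L := L) (IsCMField.complexConj L) hw) (placeForm (qsForm L) w.1))) [ν'.IsHaarMeasure],
      ∀ g₀ : ↥(unitaryGroupOfForm (galAdicCompletionMap (L := L) (IsCMField.complexConj L) hw) (placeForm (qsForm L) w.1)), ∃ U ∈ 𝓝 g₀, ∫⁻ g in U, ((((normAbs (w.1.adicCompletion L) ((((g : ↥(unitaryGroupOfForm (galAdicCompletionMap (L := L) (IsCMField.complexConj L) hw) (placeForm (qsForm L) w.1))) : GL (Fin 3) (w.1.adicCompletion L)) : Matrix (Fin 3) (Fin 3) (w.1.adicCompletion L))).charpoly.discr * ((normAbs (w.1.adicCompletion L) ((((g : ↥(unitaryGroupOfForm (galAdicCompletionMap (L := L) (IsCMField.complexConj L) hw) (placeForm (qsForm L) w.1))) : GL (Fin 3) (w.1.adicCompletion L)) : Matrix (Fin 3) (Fin 3) (w.1.adicCompletion L))).det) ^ 2)⁻¹) : ℝ≥0) : ℝ≥0∞)) ^ (-r) ∂ν' < ∞)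
    (L : Type) [Field L] [NumberField L] [IsCMField L] (v : HeightOneSpectrum (𝓞 ↥(maximalRealSubfield L)))
    (hns : ∀ w : PlacesOver L v, IsCMField.complexConj L • w.1 = w.1)
    [MeasurableSpace (Gqs L v)] [BorelSpace (Gqs L v)] (νQv : Measure (Gqs L v)) [νQv.IsHaarMeasure] :
    LocallyIntegrable (fun g : (Gqs L v) => (((((∏ w : PlacesOver L v, IsNonarchimedeanLocalField.normAbs (w.1.adicCompletion L) (((g.val : GL (Fin 3) (UnitaryGroup.LocalRing L v)).val.charpoly.discr) w)) * ((∏ w : PlacesOver L v, IsNonarchimedeanLocalField.normAbs (w.1.adicCompletion L) (((g.val : GL (Fin 3) (UnitaryGroup.LocalRing L v)).val.det) w)) ^ 2)⁻¹) : ℝ≥0) : ℝ)) ^ (-r)) νQv := by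
  obtain ⟨w⟩ := (inferInstance : Nonempty (PlacesOver L v))
  have hw := hns w
  letI : MeasurableSpace ↥(unitaryGroupOfForm (galAdicCompletionMap (L := L) (IsCMField.complexConj L) hw) (placeForm (qsForm L) w.1)) := borel _
  haveI : BorelSpace ↥(unitaryGroupOfForm (galAdicCompletionMap (L := L) (IsCMField.complexConj L) hw) (placeForm (qsForm L) w.1)) := ⟨rfl⟩
  let e' : Gqs L v ≃ₜ* ↥(unitaryGroupOfForm (galAdicCompletionMap (L := L) (IsCMField.complexConj L) hw) (placeForm (qsForm L) w.1)) :=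
    (localNonsplitEquiv (IsCMField.complexConj L) (qsForm L) (IsCMField.complexConj_ne_one L) w hw)
  haveI : (νQv.map e').IsHaarMeasure := e'.isHaarMeasure_map νQv
  exact locallyIntegrable_weylDiscr_rpow_neg_of_model L v w hw νQv hr0 (MODEL L v w hw (νQv.map e'))

/-! ## §4 The (ε8) bridge to ★ p856410 `locallyIntegrable_inv_mul_log_pow` -/

set_option synthInstance.maxHeartbeats 400000 in
-- instance search on the CM carrier `Gqs L v` is deep (as in ★ D7): raise the typeclass budget for this declaration only
/-- **`T^{−(1+δ)∕4} ∈ L¹_loc ⇒ ((√√T)^{1+δ})⁻¹ ∈ L¹_loc`** on `Gqs L v` (any measure, any real `δ`): the two integrands are EQUAL (`inv_coe_sqrt_sqrt_rpow_eq`), and the right-hand one is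
★ p856410's `hint` with `φ := √√T` (`continuous_sqrt_sqrt_tokenNN`). [cite: HarishChandra1970, Part VII §3 p. 73] -/
theorem locallyIntegrable_inv_sqrt_sqrt_pow_of_rpow
    (L : Type) [Field L] [NumberField L] [IsCMField L] (v : HeightOneSpectrum (𝓞 ↥(maximalRealSubfield L)))
    [MeasurableSpace (Gqs L v)] (νQv : Measure (Gqs L v)) {δ : ℝ}
    (h : LocallyIntegrable (fun g : (Gqs L v) => (((((∏ w : PlacesOver L v, IsNonarchimedeanLocalField.normAbs (w.1.adicCompletion L) (((g.val : GL (Fin 3) (UnitaryGroup.LocalRing L v)).val.charpoly.discr) w)) * ((∏ w : PlacesOver L v, IsNonarchimedeanLocalField.normAbs (w.1.adicCompletion L) (((g.val : GL (Fin 3) (UnitaryGroup.LocalRing L v)).val.det) w)) ^ 2)⁻¹) : ℝ≥0) : ℝ)) ^ (-((1 + δ) / 4))) νQv) :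
    LocallyIntegrable (fun g : (Gqs L v) => ((((NNReal.sqrt (NNReal.sqrt ((∏ w : PlacesOver L v, IsNonarchimedeanLocalField.normAbs (w.1.adicCompletion L) (((g.val : GL (Fin 3) (UnitaryGroup.LocalRing L v)).val.charpoly.discr) w)) * ((∏ w : PlacesOver L v, IsNonarchimedeanLocalField.normAbs (w.1.adicCompletion L) (((g.val : GL (Fin 3) (UnitaryGroup.LocalRing L v)).val.det) w)) ^ 2)⁻¹)) : ℝ≥0) : ℝ)) ^ (1 + δ))⁻¹) νQv := by
  have heq : (fun g : (Gqs L v) => ((((NNReal.sqrt (NNReal.sqrt ((∏ w : PlacesOver L v, IsNonarchimedeanLocalField.normAbs (w.1.adicCompletion L) (((g.val : GL (Fin 3) (UnitaryGroup.LocalRing L v)).val.charpoly.discr) w)) * ((∏ w : PlacesOver L v, IsNonarchimedeanLocalField.normAbs (w.1.adicCompletion L) (((g.val : GL (Fin 3) (UnitaryGroup.LocalRing L v)).val.det) w)) ^ 2)⁻¹)) : ℝ≥0) : ℝ)) ^ (1 + δ))⁻¹) =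
      fun g : (Gqs L v) => (((((∏ w : PlacesOver L v, IsNonarchimedeanLocalField.normAbs (w.1.adicCompletion L) (((g.val : GL (Fin 3) (UnitaryGroup.LocalRing L v)).val.charpoly.discr) w)) * ((∏ w : PlacesOver L v, IsNonarchimedeanLocalField.normAbs (w.1.adicCompletion L) (((g.val : GL (Fin 3) (UnitaryGroup.LocalRing L v)).val.det) w)) ^ 2)⁻¹) : ℝ≥0) : ℝ)) ^ (-((1 + δ) / 4)) := by
    funext g
    exact inv_coe_sqrt_sqrt_rpow_eq _ δ
  rw [heq]
  exact h

/-! ## §5 Consistency at the ★ exponent `r = 1∕4` (unconditional) -/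

set_option synthInstance.maxHeartbeats 400000 in
-- instance search on the CM carrier `Gqs L v` is deep (as in ★ D7): raise the typeclass budget for this declaration only
/-- **(ε7) AT `r = 1∕4` IS ★ D7-FINAL READ THROUGH THE DICTIONARY, UNCONDITIONALLY**: `g ↦ (↑T(g) : ℝ)^(−1∕4) ∈ L¹_loc(Gqs L v)` for every non-split `v` and every Haar `νQv`, from ★
`locallyIntegrable_weylDiscr_inv` (the `hDGliO` line of ★ RUNG0, tokens `(↑√√·)⁻¹`) by `coe_rpow_neg_quarter_real` alone.
[cite: HarishChandra1970, Part VII §1 Thm. 15] [cite: Rogawski1990, §4.9 p. 54; §12.5 p. 182] -/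
theorem locallyIntegrable_weylDiscr_rpow_neg_quarter
    (L : Type) [Field L] [NumberField L] [IsCMField L] (v : HeightOneSpectrum (𝓞 ↥(maximalRealSubfield L)))
    (hns : ∀ w : PlacesOver L v, IsCMField.complexConj L • w.1 = w.1)
    [MeasurableSpace (Gqs L v)] [BorelSpace (Gqs L v)] (νQv : Measure (Gqs L v)) [νQv.IsHaarMeasure] :
    LocallyIntegrable (fun g : (Gqs L v) => (((((∏ w : PlacesOver L v, IsNonarchimedeanLocalField.normAbs (w.1.adicCompletion L) (((g.val : GL (Fin 3) (UnitaryGroup.LocalRing L v)).val.charpoly.discr) w)) * ((∏ w : PlacesOver L v, IsNonarchimedeanLocalField.normAbs (w.1.adicCompletion L) (((g.val : GL (Fin 3) (UnitaryGroup.LocalRing L v)).val.det) w)) ^ 2)⁻¹) : ℝ≥0) : ℝ)) ^ (-(1 / 4 : ℝ))) νQv := by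
  simpa only [coe_rpow_neg_quarter_real] using locallyIntegrable_weylDiscr_inv L v hns νQv

/-! ## §6 ED. 2 — the MODEL statement DISCHARGED by ★ (ε6) `hcd_model_rpow`: Harish-Chandra's Theorem 15 for `U(3)` at a non-split place, exponent `r` -/

set_option synthInstance.maxHeartbeats 400000 in
-- instance search on the CM carrier `Gqs L v` is deep (as in ★ D7): raise the typeclass budget for this declaration only
/-- **(HC-D-ε) «HARISH-CHANDRA'S THEOREM 15 FOR `U(3)` AT A NON-SPLIT PLACE, EXPONENT `r`» — UNCONDITIONAL.**  For a CM field `L`, a finite place `v` of `L⁺` that does not split in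
`L` (`hns`), ANY Haar measure `νQv` on `Gqs L v = U(Φ₃)(L⁺_v)`, and every real `r` with `0 ≤ r` and `12 r < 5`: `g ↦ (↑T(g) : ℝ)^(−r) = |D_G(g)|^{−2r} ∈ L¹_loc(Gqs L v)`,
`T(g) = ∏_w N_w(discr χ_g) · (∏_w N_w(det g))⁻²` — §3 `…_of_forall_model` applied to the hypothesis-free model theorem ★ (ε6) `K2E3HCDModelRpow.hcd_model_rpow` (K2E3-p21 (g3);
itself ★ (ε0) cusp ∘ ★ (ε1) regular points ∘ ★ (ε2) Slodowy slice ∘ ★ (ε3) semisimple descent ∘ ★ (ε4) Lie globalisation ∘ ★ (ε5) group → Lie).  At `r = 1∕4` this is ★ D7-FINAL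
`locallyIntegrable_weylDiscr_inv` (§5); for `r = (1+δ)∕4`, `3δ < 2`, it is the input of ★ (ε8) `hW`. [cite: HarishChandra1970, Part VII §1 Thm. 15 p. 63; §3 p. 73]
[cite: Rogawski1990, §4.9 p. 54; §12.5 p. 182] [cite: PlatonovRapinchuk1994, §5.1] -/
theorem locallyIntegrable_weylDiscr_rpow_neg
    (L : Type) [Field L] [NumberField L] [IsCMField L] (v : HeightOneSpectrum (𝓞 ↥(maximalRealSubfield L)))
    (hns : ∀ w : PlacesOver L v, IsCMField.complexConj L • w.1 = w.1)
    [MeasurableSpace (Gqs L v)] [BorelSpace (Gqs L v)] (νQv : Measure (Gqs L v)) [νQv.IsHaarMeasure] {r : ℝ} (hr0 : 0 ≤ r) (hr5 : 12 * r < 5) :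
    LocallyIntegrable (fun g : (Gqs L v) => (((((∏ w : PlacesOver L v, IsNonarchimedeanLocalField.normAbs (w.1.adicCompletion L) (((g.val : GL (Fin 3) (UnitaryGroup.LocalRing L v)).val.charpoly.discr) w)) * ((∏ w : PlacesOver L v, IsNonarchimedeanLocalField.normAbs (w.1.adicCompletion L) (((g.val : GL (Fin 3) (UnitaryGroup.LocalRing L v)).val.det) w)) ^ 2)⁻¹) : ℝ≥0) : ℝ)) ^ (-r)) νQv :=
  locallyIntegrable_weylDiscr_rpow_neg_of_forall_model hr0
    (fun L _ _ _ v w hw _ _ ν' _ g₀ => K2E3HCDModelRpow.hcd_model_rpow L v w hw hr0 hr5 ν' g₀) L v hns νQv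

end Summit.HodgeConjecture.HodgeConjecture.Cruxes.H413.K2E3WeylDiscrLocIntRpow

end
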